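import Literature.Probability.RandomPlanarGeometry.HexSAWStripWidthThreeThirdContactMoment
import Literature.Probability.RandomPlanarGeometry.HexSAWStripWidthThreeContactVariance
import HarnessLib

/-!
# The width-three strip at criticality: the THIRD CENTRAL MOMENT of the number of surface contacts of a long bridge is LINEAR in the length, with the explicit
# universal rate `κ̂₃ = L₃ − 3L₁L₂ + 2L₁³` per hat index (`κ₃ = κ̂₃/2 = −0.10968…` per step) (module «WIDTH-THREE CONTACT SKEWNESS»)

Topic `Literature/Probability/RandomPlanarGeometry` (continues «WIDTH-THREE THIRD CONTACT MOMENT» — `W3.exists_hatC3D_three_cubic`, `W3.cubAThree/cubBThree/cubCThree`,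
the scalars `tThreeThree`, `trryThree`, `tlyyThree`, `tyyyThree` —, «WIDTH-THREE CONTACT VARIANCE» — `W3.cTwoThree` (`L₂ = c₂`), `W3.meanTopThree` — and «WIDTH-THREE
CONTACT ASYMPTOTICS» (`W3.cThree = L₁`, `W3.limDThree_pos`, `W3.tendsto_hatD_three_succ`)).  Lane «pcv-sawmu» (CriticalPhenomena venture), a-p2 g29 — the last step
towards the third contact cumulant (PREREG Am. BO blind cell P-BO-1: `κ₃(T = 3) = −0.1096812271`, predicted by implicit differentiation, HIT by replication; here a
THEOREM about the third central moment with the rate in closed form as a rational function of nine scalars of `det P`).  Setting: W. Feller I (1968) XIII.6 (moments of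
the number of renewals); nothing below is printed.

THE FORMULA.  Along the Perron root `λ(y)` of `det P(λ; y) = 0` put `L_j := (y∂_y)^jλ` at `y₃` (`λ = 1`): `L₁ = c = −T_y/T_λ`, `L₂ = c₂` («CONTACT VARIANCE») and
`L₃ = −[(T_λλλL₁ + Σr(r−1)ṫ)L₁² + 2T_λλL₁L₂ + 2((Σr(r−1)ṫ)L₁ + Σrẗ)L₁ + 2T_λyL₂ + (T_λλL₁ + T_λy)L₂ + (Σrẗ)L₁ + T_yyy]/T_λ` (the third implicit derivative;
`Σr(r−1)ṫ = trryThree − tlyThree`).  The third cumulant of `log λ(y₃e^t)` is `κ̂₃ = L₃ − 3L₁L₂ + 2L₁³` per hat index; numerically `κ̂₃ = −0.2193624543`,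
`κ₃ = κ̂₃/2 = −0.1096812271` per step (kit `HOME/pub-sawmu-a-p2/g29/kit/kappa3_check.py`, `kappa3_univ.py`).

## What is proved (namespace `…SAW.HV.W3`)
* §1 ★★ `tendsto_ratio_third_central_sub_linear` — model-free plumbing: if `K³(D − A) → 0`, `K²(C − (μ₁K + μ₀)) → 0`, `K(Q − (q₂K² + q₁K + q₀)) → 0`,
  `P − (p₃K³ + p₂K² + p₁K + p₀) → 0` (`K = k+1`), `A ≠ 0`, and the two cancellations `p₃A² − 3q₂μ₁A + 2μ₁³ = 0`, `p₂A² − 3(q₂μ₀ + q₁μ₁)A + 6μ₁²μ₀ = 0`, then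
  `P/D − 3(Q/D)(C/D) + 2(C/D)³ − (s₁/A³)K → s₀/A³` with `s₁ = p₁A² − 3(q₁μ₀ + q₀μ₁)A + 6μ₁μ₀²`, `s₀ = p₀A² − 3q₀μ₀A + 2μ₀³`.
* §2 `cThreeThree` (`L₃`), ★ `kappaHatThree = L₃ − 3L₁L₂ + 2L₁³`, ★ `kappaStepThree = κ̂₃/2`; `thirdTopThree k a b` (the third central moment of the contact count of an
  `S₃` bridge `a → b` of hat index `k` under the critical weights).
* §3 ★★★ **`tendsto_thirdTopThree_sub_linear (a b)`**: `∃ W, thirdTopThree (k+1) a b − κ̂₃·(k+1) → W` — THE THIRD CENTRAL MOMENT IS LINEAR IN THE LENGTH WITH THE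
  UNIVERSAL EXPLICIT SLOPE `κ̂₃`; `tendsto_thirdTopThree_div_hatLen` (per step: `→ κ₃ = κ̂₃/2`).

Label: LANE THEOREM (own result of lane «pcv-sawmu», a-p2 g29, 2026-08-28; not in print).  NOT claimed: the closed form of `κ₃` in `ℚ(x_c, y₃)` and an enclosure
(kit value `−0.1096812271`); the intercept; a CLT; anything at `T ≥ 4`.
-/

noncomputable section

open Finset Filter Topology Matrix Literature.Probability.LatticeModels Literature.Probability.Percolation

namespace Literature.Probability.RandomPlanarGeometry.SAW

namespace HV

namespace W3

/-! ## §1 The third-central-moment algebra of a linear law (model-free plumbing) -/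

/-- ★★ **Third central moment algebra** (plumbing).  Sequences `D, C, Q, P` with `K³(D_k − A) → 0`, `K²(C_k − (μ₁K + μ₀)) → 0`, `K(Q_k − (q₂K² + q₁K + q₀)) → 0`,
`P_k − (p₃K³ + p₂K² + p₁K + p₀) → 0` (`K = k + 1`), `A ≠ 0`, and the cancellations `p₃A² − 3q₂μ₁A + 2μ₁³ = 0`, `p₂A² − 3(q₂μ₀ + q₁μ₁)A + 6μ₁²μ₀ = 0`: then
`P/D − 3(Q/D)(C/D) + 2(C/D)³ − (s₁/A³)K → s₀/A³`, `s₁ = p₁A² − 3(q₁μ₀ + q₀μ₁)A + 6μ₁μ₀²`, `s₀ = p₀A² − 3q₀μ₀A + 2μ₀³`.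
[cite: Feller1968, XIII.6 (moments of the number of renewals); lane «pcv-sawmu» a-p2 g29 — plumbing] -/
theorem tendsto_ratio_third_central_sub_linear {D C Q P : ℕ → ℝ} {A μ₁ μ₀ q₂ q₁ q₀ p₃ p₂ p₁ p₀ : ℝ} (hA : A ≠ 0)
    (h3 : p₃ * A ^ 2 - 3 * q₂ * μ₁ * A + 2 * μ₁ ^ 3 = 0)
    (h2 : p₂ * A ^ 2 - 3 * (q₂ * μ₀ + q₁ * μ₁) * A + 6 * μ₁ ^ 2 * μ₀ = 0)
    (hD : Tendsto (fun k : ℕ => ((k : ℝ) + 1) ^ 3 * (D k - A)) atTop (𝓝 0))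
    (hC : Tendsto (fun k : ℕ => ((k : ℝ) + 1) ^ 2 * (C k - (μ₁ * ((k : ℝ) + 1) + μ₀))) atTop (𝓝 0))
    (hQ : Tendsto (fun k : ℕ => ((k : ℝ) + 1) * (Q k - (q₂ * ((k : ℝ) + 1) ^ 2 + q₁ * ((k : ℝ) + 1) + q₀))) atTop (𝓝 0))
    (hP : Tendsto (fun k : ℕ => P k - (p₃ * ((k : ℝ) + 1) ^ 3 + p₂ * ((k : ℝ) + 1) ^ 2 + p₁ * ((k : ℝ) + 1) + p₀)) atTop (𝓝 0)) :
    Tendsto (fun k : ℕ => P k / D k - 3 * (Q k / D k) * (C k / D k) + 2 * (C k / D k) ^ 3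
      - (p₁ * A ^ 2 - 3 * (q₁ * μ₀ + q₀ * μ₁) * A + 6 * μ₁ * μ₀ ^ 2) / A ^ 3 * ((k : ℝ) + 1)) atTop
      (𝓝 ((p₀ * A ^ 2 - 3 * q₀ * μ₀ * A + 2 * μ₀ ^ 3) / A ^ 3)) := by
  -- notation
  set s₁ : ℝ := p₁ * A ^ 2 - 3 * (q₁ * μ₀ + q₀ * μ₁) * A + 6 * μ₁ * μ₀ ^ 2 with hs₁
  set s₀ : ℝ := p₀ * A ^ 2 - 3 * q₀ * μ₀ * A + 2 * μ₀ ^ 3 with hs₀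
  have hinv : Tendsto (fun k : ℕ => ((k : ℝ) + 1)⁻¹) atTop (𝓝 0) := by
    have := (tendsto_one_div_add_atTop_nhds_zero_nat : Tendsto (fun n : ℕ => 1 / ((n : ℝ) + 1)) atTop (𝓝 0))
    simpa using this
  have hKne : ∀ k : ℕ, ((k : ℝ) + 1) ≠ 0 := fun k => by positivity
  -- D → A and the eventual non-vanishing of D
  have hD0 : Tendsto (fun k : ℕ => D k - A) atTop (𝓝 0) := by
    have t := hD.mul ((hinv.mul hinv).mul hinv)
    rw [zero_mul] at t
    refine t.congr fun k => ?_
    field_simp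
  have hDA : Tendsto D atTop (𝓝 A) := by have := hD0.add_const A; simpa using this
  have hDne : ∀ᶠ k : ℕ in atTop, D k ≠ 0 := hDA.eventually_ne hA
  have hDinv : Tendsto (fun k : ℕ => (D k)⁻¹) atTop (𝓝 A⁻¹) := hDA.inv₀ hA
  -- the three ratio errors
  set εx : ℕ → ℝ := fun k => C k / D k - (μ₁ * ((k : ℝ) + 1) + μ₀) / A with hεx
  set εy : ℕ → ℝ := fun k => Q k / D k - (q₂ * ((k : ℝ) + 1) ^ 2 + q₁ * ((k : ℝ) + 1) + q₀) / A with hεy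
  set εz : ℕ → ℝ := fun k => P k / D k - (p₃ * ((k : ℝ) + 1) ^ 3 + p₂ * ((k : ℝ) + 1) ^ 2 + p₁ * ((k : ℝ) + 1) + p₀) / A with hεz
  -- `K² εx → 0`
  have hx2 : Tendsto (fun k : ℕ => ((k : ℝ) + 1) ^ 2 * εx k) atTop (𝓝 0) := by
    have t1 := hC.mul hDinv
    have t2 := ((hinv.const_mul μ₀).const_add μ₁).mul (hD.mul (hDinv.const_mul A⁻¹))
    have t := t1.sub t2
    simp only [mul_zero, zero_mul, add_zero, sub_zero] at t
    refine t.congr' ?_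
    filter_upwards [hDne] with k hk
    rw [hεx]
    field_simp
    ring
  -- `K εy → 0`
  have hy1 : Tendsto (fun k : ℕ => ((k : ℝ) + 1) * εy k) atTop (𝓝 0) := by
    have t1 := hQ.mul hDinv
    have t2 := ((((hinv.mul hinv).const_mul q₀).add (hinv.const_mul q₁)).const_add q₂).mul (hD.mul (hDinv.const_mul A⁻¹))
    have t := t1.sub t2
    simp only [mul_zero, zero_mul, add_zero, sub_zero] at t
    refine t.congr' ?_
    filter_upwards [hDne] with k hk
    rw [hεy]
    field_simp
    ring
  -- `εz → 0`
  have hz0 : Tendsto εz atTop (𝓝 0) := by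
    have t1 := hP.mul hDinv
    have t2 := (((((hinv.mul (hinv.mul hinv)).const_mul p₀).add ((hinv.mul hinv).const_mul p₁)).add (hinv.const_mul p₂)).const_add p₃).mul
      (hD.mul (hDinv.const_mul A⁻¹))
    have t := t1.sub t2
    simp only [mul_zero, zero_mul, add_zero, sub_zero] at t
    refine t.congr' ?_
    filter_upwards [hDne] with k hk
    rw [hεz]
    field_simp
    ring
  -- lower powers
  have hx1 : Tendsto (fun k : ℕ => ((k : ℝ) + 1) * εx k) atTop (𝓝 0) := by
    have t := hx2.mul hinv; rw [zero_mul] at t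
    exact t.congr fun k => by field_simp
  have hx0 : Tendsto εx atTop (𝓝 0) := by
    have t := hx1.mul hinv; rw [zero_mul] at t
    exact t.congr fun k => by field_simp
  have hy0 : Tendsto εy atTop (𝓝 0) := by
    have t := hy1.mul hinv; rw [zero_mul] at t
    exact t.congr fun k => by field_simp
  -- the exact cubic part: `P₀A² − 3Q₀C₀A + 2C₀³ = s₁K + s₀`
  have hN0 : ∀ k : ℕ, (p₃ * ((k : ℝ) + 1) ^ 3 + p₂ * ((k : ℝ) + 1) ^ 2 + p₁ * ((k : ℝ) + 1) + p₀) * A ^ 2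
      - 3 * (q₂ * ((k : ℝ) + 1) ^ 2 + q₁ * ((k : ℝ) + 1) + q₀) * (μ₁ * ((k : ℝ) + 1) + μ₀) * A + 2 * (μ₁ * ((k : ℝ) + 1) + μ₀) ^ 3
      = s₁ * ((k : ℝ) + 1) + s₀ := by
    intro k
    rw [hs₁, hs₀]
    linear_combination ((k : ℝ) + 1) ^ 3 * h3 + ((k : ℝ) + 1) ^ 2 * h2
  -- the error expansion (exact Taylor expansion of the cubic form)
  have key : ∀ k : ℕ, P k / D k - 3 * (Q k / D k) * (C k / D k) + 2 * (C k / D k) ^ 3 - s₁ / A ^ 3 * ((k : ℝ) + 1) - s₀ / A ^ 3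
      = εz k - 3 * ((q₂ * ((k : ℝ) + 1) ^ 2 + q₁ * ((k : ℝ) + 1) + q₀) / A) * εx k
        - 3 * ((μ₁ * ((k : ℝ) + 1) + μ₀) / A) * εy k - 3 * εx k * εy k
        + 6 * ((μ₁ * ((k : ℝ) + 1) + μ₀) / A) ^ 2 * εx k + 6 * ((μ₁ * ((k : ℝ) + 1) + μ₀) / A) * εx k ^ 2 + 2 * εx k ^ 3 := by
    intro k
    have e0 : (p₃ * ((k : ℝ) + 1) ^ 3 + p₂ * ((k : ℝ) + 1) ^ 2 + p₁ * ((k : ℝ) + 1) + p₀) / A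
        - 3 * ((q₂ * ((k : ℝ) + 1) ^ 2 + q₁ * ((k : ℝ) + 1) + q₀) / A) * ((μ₁ * ((k : ℝ) + 1) + μ₀) / A)
        + 2 * ((μ₁ * ((k : ℝ) + 1) + μ₀) / A) ^ 3
        = ((p₃ * ((k : ℝ) + 1) ^ 3 + p₂ * ((k : ℝ) + 1) ^ 2 + p₁ * ((k : ℝ) + 1) + p₀) * A ^ 2
          - 3 * (q₂ * ((k : ℝ) + 1) ^ 2 + q₁ * ((k : ℝ) + 1) + q₀) * (μ₁ * ((k : ℝ) + 1) + μ₀) * A + 2 * (μ₁ * ((k : ℝ) + 1) + μ₀) ^ 3) / A ^ 3 := by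
      field_simp
    have e : (p₃ * ((k : ℝ) + 1) ^ 3 + p₂ * ((k : ℝ) + 1) ^ 2 + p₁ * ((k : ℝ) + 1) + p₀) / A
        - 3 * ((q₂ * ((k : ℝ) + 1) ^ 2 + q₁ * ((k : ℝ) + 1) + q₀) / A) * ((μ₁ * ((k : ℝ) + 1) + μ₀) / A)
        + 2 * ((μ₁ * ((k : ℝ) + 1) + μ₀) / A) ^ 3 = s₁ / A ^ 3 * ((k : ℝ) + 1) + s₀ / A ^ 3 := by
      rw [e0, hN0 k]
      ring
    rw [hεx, hεy, hεz]
    linear_combination e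
  -- every error term tends to zero
  have hlim : Tendsto (fun k : ℕ => εz k - 3 * ((q₂ * ((k : ℝ) + 1) ^ 2 + q₁ * ((k : ℝ) + 1) + q₀) / A) * εx k
        - 3 * ((μ₁ * ((k : ℝ) + 1) + μ₀) / A) * εy k - 3 * εx k * εy k
        + 6 * ((μ₁ * ((k : ℝ) + 1) + μ₀) / A) ^ 2 * εx k + 6 * ((μ₁ * ((k : ℝ) + 1) + μ₀) / A) * εx k ^ 2 + 2 * εx k ^ 3) atTop (𝓝 0) := by
    -- `Q₀/A · εx = (q₂ K²εx + q₁ Kεx + q₀ εx)/A`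
    have a1 : Tendsto (fun k : ℕ => ((q₂ * ((k : ℝ) + 1) ^ 2 + q₁ * ((k : ℝ) + 1) + q₀) / A) * εx k) atTop (𝓝 0) := by
      have t := ((hx2.const_mul q₂).add ((hx1.const_mul q₁).add (hx0.const_mul q₀))).mul_const A⁻¹
      simp only [mul_zero, add_zero, zero_mul] at t
      exact t.congr fun k => by ring
    have a2 : Tendsto (fun k : ℕ => ((μ₁ * ((k : ℝ) + 1) + μ₀) / A) * εy k) atTop (𝓝 0) := by
      have t := ((hy1.const_mul μ₁).add (hy0.const_mul μ₀)).mul_const A⁻¹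
      simp only [mul_zero, add_zero, zero_mul] at t
      exact t.congr fun k => by ring
    have a3 : Tendsto (fun k : ℕ => εx k * εy k) atTop (𝓝 0) := by
      have t := hx0.mul hy0; rw [mul_zero] at t; exact t
    have a4 : Tendsto (fun k : ℕ => ((μ₁ * ((k : ℝ) + 1) + μ₀) / A) ^ 2 * εx k) atTop (𝓝 0) := by
      have t := (((hx2.const_mul (μ₁ ^ 2)).add ((hx1.const_mul (2 * μ₁ * μ₀)).add (hx0.const_mul (μ₀ ^ 2)))).mul_const (A⁻¹ ^ 2))
      simp only [mul_zero, add_zero, zero_mul] at t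
      exact t.congr fun k => by ring
    have a5 : Tendsto (fun k : ℕ => ((μ₁ * ((k : ℝ) + 1) + μ₀) / A) * εx k ^ 2) atTop (𝓝 0) := by
      have t := (((hx1.const_mul μ₁).add (hx0.const_mul μ₀)).mul hx0).mul_const A⁻¹
      simp only [mul_zero, add_zero, zero_mul] at t
      exact t.congr fun k => by ring
    have a6 : Tendsto (fun k : ℕ => εx k ^ 3) atTop (𝓝 0) := by
      have t := hx0.pow 3; rw [zero_pow three_ne_zero] at t; exact t
    have t := (((((hz0.sub (a1.const_mul 3)).sub (a2.const_mul 3)).sub (a3.const_mul 3)).add (a4.const_mul 6)).add (a5.const_mul 6)).add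
      (a6.const_mul 2)
    simp only [mul_zero, sub_zero, add_zero] at t
    refine t.congr fun k => ?_
    ring
  have t := hlim.add_const (s₀ / A ^ 3)
  rw [zero_add] at t
  refine t.congr fun k => ?_
  rw [← key k]
  ring

/-! ## §2 The constants and the statistic -/

/-- `L₃ := (y∂_y)³λ(y₃)` — the third implicit derivative of the Perron root per hat index, from `det P` (see the module docstring for the formula;
`Σr(r−1)ṫ_r = trryThree − tlyThree`). [cite: Feller1968, XIII.6; lane «pcv-sawmu» a-p2 g29] -/
def cThreeThree : ℝ :=
  -((tThreeThree * cThree + (trryThree - tlyThree)) * cThree ^ 2 + 2 * tTwoThree * cThree * cTwoThree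
      + 2 * ((trryThree - tlyThree) * cThree + tlyyThree) * cThree + 2 * tlyThree * cTwoThree + (tTwoThree * cThree + tlyThree) * cTwoThree
      + tlyyThree * cThree + tyyyThree) / tOneThree

/-- ★ `κ̂₃ := L₃ − 3L₁L₂ + 2L₁³` — the third cumulant rate of the surface-contact count PER HAT INDEX (numerically `−0.2193624543`).
[cite: Feller1968, XIII.6; lane «pcv-sawmu» a-p2 g29] -/
def kappaHatThree : ℝ := cThreeThree - 3 * cThree * cTwoThree + 2 * cThree ^ 3

/-- ★ `κ₃ := κ̂₃/2` — the third cumulant rate PER STEP (numerically `−0.1096812271`, PREREG Am. BO cell P-BO-1). [cite: Feller1968, XIII.6; lane «pcv-sawmu» a-p2 g29] -/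
def kappaStepThree : ℝ := kappaHatThree / 2

/-- The third central moment of the number of surface contacts of a bridge `a → b` of `S₃` with hat index `k` under the critical weights:
`Ĉ³/D̂ − 3(Ĉ²/D̂)(Ĉ/D̂) + 2(Ĉ/D̂)³`. [cite: Feller1968, XIII.6; DuminilCopinHammond2013, §2.2; lane «pcv-sawmu» a-p2 g29] -/
def thirdTopThree (k : ℕ) (a b : Fin (2 * 3)) : ℝ :=
  hatC3D (stripYT 3) k a b / hatD 3 (stripYT 3) k a b - 3 * (hatC2D (stripYT 3) k a b / hatD 3 (stripYT 3) k a b) * meanTopThree k a b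
    + 2 * meanTopThree k a b ^ 3

/-! ## §3 The third central moment law -/

/-- The forced forms of the cubic-law constants: `α = 3c³A`, `β = 3cℓ + 3cA·c₂`, `ℓ = A(c₂ − c²) + 2cm₀` (`ℓ = linQThree A m₀`), from `c·T_λ = −T_y` (plumbing).
[cite: Feller1968, XIII.6; lane «pcv-sawmu» a-p2 g29] -/
theorem cubic_constants_three (hT : tOneThree ≠ 0) (A m₀ : ℝ) :
    cubAThree A = 3 * cThree ^ 3 * A ∧ linQThree A m₀ = A * (cTwoThree - cThree ^ 2) + 2 * cThree * m₀ ∧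
      cubBThree A m₀ = 3 * cThree * linQThree A m₀ + 3 * cThree * A * cTwoThree := by
  have hty : tyThree = -(cThree * tOneThree) := by
    have : cThree * tOneThree = -tyThree := by rw [cThree]; field_simp
    linarith
  refine ⟨?_, ?_, ?_⟩
  · rw [cubAThree, cubSrc2Three, hty]; field_simp
  · rw [linQThree, cTwoThree, hty]; field_simp; ring
  · rw [cubBThree, cubSrc1Three, cubAThree, cubSrc2Three, linQThree, cTwoThree, hty]; field_simp; ring

/-- ★ **The skewness-rate identity**: the slope `s₁/A³` produced by the third-central-moment algebra from the forced cubic-law constants equals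
`κ̂₃ = L₃ − 3L₁L₂ + 2L₁³` — independent of the level pair `A` and of the intercepts `m₀, m₂` (they cancel). [cite: Feller1968, XIII.6; lane «pcv-sawmu» a-p2 g29 — own] -/
theorem skewRate_identity_three (hT : tOneThree ≠ 0) {A : ℝ} (hA : A ≠ 0) (m₀ m₂ : ℝ) :
    ((cubAThree A - (cubBThree A m₀ - cubAThree A) + (cubAThree A / 6 - cubBThree A m₀ / 2 + cubCThree A m₀ m₂)) * A ^ 2
        - 3 * ((linQThree A m₀ - 2 * cThree ^ 2 * A) * (m₀ - cThree * A) + (m₂ - linQThree A m₀ + cThree ^ 2 * A) * (cThree * A)) * A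
        + 6 * (cThree * A) * (m₀ - cThree * A) ^ 2) / A ^ 3 = kappaHatThree := by
  have hty : tyThree = -(cThree * tOneThree) := by
    have : cThree * tOneThree = -tyThree := by rw [cThree]; field_simp
    linarith
  obtain ⟨hα, hℓ, hβ⟩ := cubic_constants_three hT A m₀
  rw [div_eq_iff (pow_ne_zero 3 hA)]
  rw [cubCThree, cubSrc0Three, hβ, hα, hℓ, kappaHatThree, cThreeThree, cTwoThree, hty]
  field_simp
  ring

/-- ★★★ **THE WIDTH-THREE CONTACT SKEWNESS LAW.**  For every pair of levels `a, b` there is an intercept `W` with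
`thirdTopThree (k+1) a b − κ̂₃·(k+1) → W`, `κ̂₃ = kappaHatThree = L₃ − 3L₁L₂ + 2L₁³`: the third central moment of the number of surface contacts of a critical `S₃`
bridge is LINEAR in the hat index with a universal explicit slope.  (Inputs: `D̂ → A > 0` at rate `(n+1)^{23}0.97ⁿ` (#1457), the linear/quadratic/cubic laws of
`Ĉ, Ĉ², Ĉ³` with forced leading coefficients («CONTACT ASYMPTOTICS», «THIRD CONTACT MOMENT»), §1's algebra, `cubic_constants_three`, `skewRate_identity_three`.)
[cite: Feller1968, XIII.6 (moments of the number of renewals); DuminilCopinHammond2013, §2.2; lane «pcv-sawmu» a-p2 g29 — own result, not in print] -/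
theorem tendsto_thirdTopThree_sub_linear (a b : Fin (2 * 3)) :
    ∃ W : ℝ, Tendsto (fun k : ℕ => thirdTopThree (k + 1) a b - kappaHatThree * ((k : ℝ) + 1)) atTop (𝓝 W) := by
  obtain ⟨m₀, m₂, m₃, K, hb₁, hb₂, hb₃⟩ := exists_hatC3D_three_cubic a b
  have hT : tOneThree ≠ 0 := (exists_hatCD_three_linear a b).1
  obtain ⟨K₀, hK₀⟩ := abs_hatD_three_sub_lim_le
  set A : ℝ := limDThree a b with hA
  have hApos : 0 < A := limDThree_pos a b
  have hAne : A ≠ 0 := hApos.ne'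
  obtain ⟨hα, hℓ, hβ⟩ := cubic_constants_three hT A m₀
  have hR0 : (0 : ℝ) < 97 / 100 := by norm_num
  have hR1 : (97 / 100 : ℝ) < 1 := by norm_num
  -- the four inputs in (k+1)-indexing
  have hD : Tendsto (fun k : ℕ => ((k : ℝ) + 1) ^ 3 * (hatD 3 (stripYT 3) (k + 1) a b - A)) atTop (𝓝 0) :=
    Literature.Analysis.tendsto_succ_pow_mul_of_abs_le (e := fun n => hatD 3 (stripYT 3) (n + 1) a b - A) hR0 hR1 (fun n => hK₀ a b n) 3
  have hC : Tendsto (fun k : ℕ => ((k : ℝ) + 1) ^ 2 * (hatCD (stripYT 3) (k + 1) a b - (cThree * A * ((k : ℝ) + 1) + (m₀ - cThree * A)))) atTop (𝓝 0) := by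
    have h := Literature.Analysis.tendsto_succ_pow_mul_of_abs_le (e := fun n => hatCD (stripYT 3) (n + 1) a b - (cThree * A * (n : ℝ) + m₀)) hR0 hR1 hb₁ 2
    refine h.congr fun k => ?_
    ring
  have hQ : Tendsto (fun k : ℕ => ((k : ℝ) + 1) * (hatC2D (stripYT 3) (k + 1) a b
      - (cThree ^ 2 * A * ((k : ℝ) + 1) ^ 2 + (linQThree A m₀ - 2 * cThree ^ 2 * A) * ((k : ℝ) + 1)
        + (m₂ - linQThree A m₀ + cThree ^ 2 * A)))) atTop (𝓝 0) := by
    have h := Literature.Analysis.tendsto_succ_pow_mul_of_abs_le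
      (e := fun n => hatC2D (stripYT 3) (n + 1) a b - (cThree ^ 2 * A * (n : ℝ) ^ 2 + linQThree A m₀ * (n : ℝ) + m₂)) hR0 hR1 hb₂ 1
    simp only [pow_one] at h
    refine h.congr fun k => ?_
    ring
  have hP : Tendsto (fun k : ℕ => hatC3D (stripYT 3) (k + 1) a b
      - (cubAThree A / 3 * ((k : ℝ) + 1) ^ 3 + ((cubBThree A m₀ - cubAThree A) / 2 - cubAThree A) * ((k : ℝ) + 1) ^ 2
        + (cubAThree A - (cubBThree A m₀ - cubAThree A) + (cubAThree A / 6 - cubBThree A m₀ / 2 + cubCThree A m₀ m₂)) * ((k : ℝ) + 1)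
        + (m₃ - (cubAThree A / 6 - cubBThree A m₀ / 2 + cubCThree A m₀ m₂) + (cubBThree A m₀ - cubAThree A) / 2 - cubAThree A / 3))) atTop (𝓝 0) := by
    have h := Literature.Analysis.tendsto_succ_pow_mul_of_abs_le
      (e := fun n => hatC3D (stripYT 3) (n + 1) a b - (cubAThree A / 3 * (n : ℝ) ^ 3 + (cubBThree A m₀ - cubAThree A) / 2 * (n : ℝ) ^ 2
        + (cubAThree A / 6 - cubBThree A m₀ / 2 + cubCThree A m₀ m₂) * (n : ℝ) + m₃)) hR0 hR1 hb₃ 0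
    simp only [pow_zero, one_mul] at h
    refine h.congr fun k => ?_
    ring
  -- the two cancellations
  have h3 : cubAThree A / 3 * A ^ 2 - 3 * (cThree ^ 2 * A) * (cThree * A) * A + 2 * (cThree * A) ^ 3 = 0 := by
    rw [hα]; ring
  have h2 : ((cubBThree A m₀ - cubAThree A) / 2 - cubAThree A) * A ^ 2
      - 3 * (cThree ^ 2 * A * (m₀ - cThree * A) + (linQThree A m₀ - 2 * cThree ^ 2 * A) * (cThree * A)) * A
      + 6 * (cThree * A) ^ 2 * (m₀ - cThree * A) = 0 := by
    rw [hβ, hα, hℓ]; ring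
  have h := tendsto_ratio_third_central_sub_linear (D := fun k => hatD 3 (stripYT 3) (k + 1) a b) (C := fun k => hatCD (stripYT 3) (k + 1) a b)
    (Q := fun k => hatC2D (stripYT 3) (k + 1) a b) (P := fun k => hatC3D (stripYT 3) (k + 1) a b) hAne h3 h2 hD hC hQ hP
  rw [skewRate_identity_three hT hAne m₀ m₂] at h
  refine ⟨_, h.congr fun k => ?_⟩
  simp only [thirdTopThree, meanTopThree]

/-- Corollary: `thirdTopThree k a b / k → κ̂₃`. [cite: Feller1968, XIII.6; lane «pcv-sawmu» a-p2 g29] -/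
theorem tendsto_thirdTopThree_div (a b : Fin (2 * 3)) :
    Tendsto (fun k : ℕ => thirdTopThree k a b / (k : ℝ)) atTop (𝓝 kappaHatThree) := by
  obtain ⟨W, h⟩ := tendsto_thirdTopThree_sub_linear a b
  have hinv : Tendsto (fun k : ℕ => ((k : ℝ) + 1)⁻¹) atTop (𝓝 0) := by
    have := (tendsto_one_div_add_atTop_nhds_zero_nat : Tendsto (fun n : ℕ => 1 / ((n : ℝ) + 1)) atTop (𝓝 0))
    simpa using this
  have t := (h.mul hinv).add_const kappaHatThree
  rw [mul_zero, zero_add] at t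
  have t' : Tendsto (fun k : ℕ => thirdTopThree (k + 1) a b / (((k + 1 : ℕ) : ℝ))) atTop (𝓝 kappaHatThree) := by
    refine t.congr fun k => ?_
    have hk : ((k : ℝ) + 1) ≠ 0 := by positivity
    push_cast
    field_simp
    ring
  exact (tendsto_add_atTop_iff_nat 1).1 t'

/-- ★★★ **PER STEP** (cell P-BO-1 of the lane register): `thirdTopThree k a b / (number of steps) → κ₃ = kappaStepThree = κ̂₃/2` (`= −0.1096812271…`) — the
third cumulant rate of the surface-contact count of the critical width-three strip, for every pair of end levels (the distribution is left-skewed at the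
linear scale). [cite: Feller1968, XIII.6; DuminilCopinHammond2013, §2.2; lane «pcv-sawmu» a-p2 g29 — own result, not in print] -/
theorem tendsto_thirdTopThree_div_hatLen (a b : Fin (2 * 3)) :
    Tendsto (fun k : ℕ => thirdTopThree k a b / ((hatLen k a b : ℤ) : ℝ)) atTop (𝓝 kappaStepThree) := by
  have h := tendsto_thirdTopThree_div a b
  have t := h.mul (tendsto_div_hatLen_three a b)
  have hlim : kappaHatThree * (1 / 2) = kappaStepThree := by rw [kappaStepThree]; ring
  rw [hlim] at t
  refine t.congr' ?_
  filter_upwards [eventually_gt_atTop 0] with k hk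
  have hk' : (k : ℝ) ≠ 0 := by exact_mod_cast hk.ne'
  field_simp

end W3

end HV

end Literature.Probability.RandomPlanarGeometry.SAW
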